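import Summits.Ventures.CertifiedManyBodySolver.Downfold.EmeryShapeWindowClosureBand
import Summits.Ventures.CertifiedManyBodySolver.Downfold.EmeryFermiScalePointsHg1212K26VirtualCorners
import HarnessLib

/-!
# THE ONE-BAND FERMI-SURFACE SHAPE `t′/t` OF THE WHOLE TYPED 3BE BOX `emeryBoxHg1212K26Src (EmeryBoxesKSlicesG)` OVER ITS WHOLE FILLING BAND (two-ray rule + band window closure, §B.86 (k);
# router/EMERY-SHAPE-CORNERS.tsv «band» row)

Venture CertifiedManyBodySolver, cell `pub/hubbard-downfold` (stage S1; INFLATION-RULES-3to1-B §B.86 (k)), seat hubbard-downfold-mod-4 (technique B, g35); namespace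
`Summit.Ventures.CertifiedManyBodySolver.Downfold.Emery`. Everything PROVED (0 sorry). WHAT THIS IS NOT: a statement about HgBa₂CaCu₂O₆₊δ plane ((K) source box) — the typed box is SCREENING-GRADE;
`U = 0` one-body kinematics of the σ model (rigid band); object E = the EXACT `t–t′` shape of the σ Fermi surface.

**For EVERY one-body row of the box AND EVERY filling of the band n_H ∈ [1.1600000000000001, 1.2] (ν ∈ [2/5, 21/50]): n_H = 1.16 (ν = 21/50) … n_H = 1.20 (ν = 2/5), the one-band t′/t of the σ Fermi surface at that row's own Fermi energy lies in
[-0.3067, -0.2686]** (`hg1212K26Box_fsRatio_band`) — `fsRatio_fermiEnergyOf_mem_Icc_windowClosure_band` with the end-filling point brackets: lower window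
[ε_F(V_lo; ν₁)⁻, ε_F(A_lo; ν₂)⁺] = [1.4888, 1.5611] (closure lipschitz), upper window [0, ε_F(V_hi; ν₂)⁺] = [0, 1.5091] (monotone), regime at ε_F(H; ν₂)⁺ = 1.6926. The per-filling windows of
`EmeryBoxesHg1212K26ShapeCorners` are nested inside (same certificates).

Sources: three-band model [HybertsenSchluterChristensen1989, Eq. (1)]; [AndersenEtAl1995, §6]; box rows as cited in the typed object's file.
-/

noncomputable section

namespace Summit.Ventures.CertifiedManyBodySolver.Downfold.Emery

open Real Set

/-- **HgBa₂CaCu₂O₆₊δ plane ((K) source box), filling band n_H ∈ [1.1600000000000001, 1.2] (ν ∈ [2/5, 21/50]): n_H = 1.16 (ν = 21/50) … n_H = 1.20 (ν = 2/5): for every row of the box and every filling of the band, the one-band Fermi-surface `t′/t` (object E) lies in `[-0.3067, -0.2686]`.** [folklore] -/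
theorem hg1212K26Box_fsRatio_band {Δ a b c ν : ℝ} (hΔ : Δ ∈ Icc ((37 : ℝ) / 20) ((49 : ℝ) / 20)) (ha : a ∈ Icc ((241 : ℝ) / 200) ((32 : ℝ) / 25)) (hb : b ∈ Icc ((161 : ℝ) / 250) ((663 : ℝ) / 1000)) (hc : c ∈ Icc ((163 : ℝ) / 1000) ((187 : ℝ) / 1000)) (hν : ν ∈ Icc ((2 : ℝ) / 5) ((21 : ℝ) / 50)) :
    fsRatio Δ a b c (fermiEnergyOf Δ a b c ν) ∈ Icc ((-3067 : ℝ) / 10000) ((-1343 : ℝ) / 5000) := by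
  have hV : ((187 : ℝ) / 1000) * ((663 : ℝ) / 1000) / ((161 : ℝ) / 250) = ((123981 : ℝ) / 644000) := by norm_num
  have hW : ((163 : ℝ) / 1000) * ((161 : ℝ) / 250) / ((663 : ℝ) / 1000) = ((26243 : ℝ) / 165750) := by norm_num
  have hVlo := (fermiEnergyOf_of_pointBracketCheck virtPt_Hg1212K26Vlo_nH120_br (by norm_num) (by norm_num) (by norm_num) (ν := (2/5 : ℝ)) (by push_cast; exact ⟨le_rfl, le_rfl⟩)).2
  have hVhi := (fermiEnergyOf_of_pointBracketCheck virtPt_Hg1212K26Vhi_nH116_br (by norm_num) (by norm_num) (by norm_num) (ν := (21/50 : ℝ)) (by push_cast; exact ⟨le_rfl, le_rfl⟩)).2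
  have hAlo := (fermiEnergyOf_of_pointBracketCheck virtPt_Hg1212K26Alo_nH116_br (by norm_num) (by norm_num) (by norm_num) (ν := (21/50 : ℝ)) (by push_cast; exact ⟨le_rfl, le_rfl⟩)).2
  have hTop := (fermiEnergyOf_of_pointBracketCheck virtPt_Hg1212K26H_nH116_br (by norm_num) (by norm_num) (by norm_num) (ν := (21/50 : ℝ)) (by push_cast; exact ⟨le_rfl, le_rfl⟩)).2
  have hLo2 := (fermiEnergyOf_of_pointBracketCheck virtPt_Hg1212K26Vlo_nH120_br (by norm_num) (by norm_num) (by norm_num) (ν := (2/5 : ℝ)) (by push_cast; exact ⟨le_rfl, le_rfl⟩)).2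
  push_cast at hVlo hVhi hAlo hTop
  norm_num at hVlo hVhi hAlo hTop
  refine fsRatio_fermiEnergyOf_mem_Icc_windowClosure_band (Δ₁ := ((37 : ℝ) / 20)) (Δ₂ := ((49 : ℝ) / 20)) (a₁ := ((241 : ℝ) / 200)) (a₂ := ((32 : ℝ) / 25)) (b₁ := ((161 : ℝ) / 250))
    (b₂ := ((663 : ℝ) / 1000)) (c₁ := ((163 : ℝ) / 1000)) (c₂ := ((187 : ℝ) / 1000)) (e₁ := ((1861 : ℝ) / 1250)) (e₂ := ((15611 : ℝ) / 10000)) (e₃ := 0) (e₄ := ((15091 : ℝ) / 10000)) (ν₁ := ((2 : ℝ) / 5)) (ν₂ := ((21 : ℝ) / 50)) (by norm_num) (by norm_num) (by norm_num) (by norm_num)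
    (by norm_num) hΔ ha hb hc (by norm_num) hν (by norm_num) ?_ ?_ ?_ (by norm_num) ?_ ?_ ?_ (by norm_num) ?_
  · nlinarith [hTop.2]
  · rw [hV]; exact hVlo.1
  · exact hAlo.2
  · intro ε hε
    rw [hV]
    have hlip := fsRatio_ge_on_window (Δ := ((37 : ℝ) / 20)) (a := ((241 : ℝ) / 200)) (b := ((663 : ℝ) / 1000)) (c := ((123981 : ℝ) / 644000)) (p := ((1861 : ℝ) / 1250)) (q := ((15611 : ℝ) / 10000))
      (M := ((57 : ℝ) / 1250)) (by norm_num) (by norm_num) (by norm_num) (by norm_num) (by norm_num [fsD, fsN]) (by norm_num [dopingDisc]) (by norm_num [dopingDisc]) hε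
    refine le_trans ?_ hlip
    norm_num [fsRatio, fsD, fsN]
  · exact (fermiEnergyOf_pos (by norm_num) (by norm_num) (by norm_num) (by norm_num) (by norm_num) (by norm_num)).le
  · rw [hW]; exact hVhi.2
  · intro ε hε
    rw [hW]
    have hmono := (fsRatio_mem_Icc_on_window_of_dopingDisc_nonpos (Δ := ((49 : ℝ) / 20)) (a := ((32 : ℝ) / 25)) (b := ((161 : ℝ) / 250)) (c := ((26243 : ℝ) / 165750))
      (p := 0) (q := ((15091 : ℝ) / 10000)) (by norm_num) (by norm_num) (by norm_num) (by norm_num) (by norm_num) (by norm_num) (by norm_num)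
      (by norm_num [dopingDisc]) hε).2
    refine le_trans hmono ?_
    norm_num [fsRatio, fsD, fsN]

end Summit.Ventures.CertifiedManyBodySolver.Downfold.Emery
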